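import Summits.QuantumFields.YangMills.Theorems.AlphaInputsT3ACv3AvgIterLocality
import Summits.QuantumFields.YangMills.Theorems.RevelationMartingaleProxyQuadraticVariation
import HarnessLib

/-!
# Route RevelationMartingale (line «revelation_martingale» on crux `HistoryTailL`, stmt-QuantumFields-19936) —
# THE SUPPORT HORIZON of the bond revelation: once the four `j`-blocks of `∂p` are revealed, every later increment vanishes

Cell `ym3-torus` (YM ladder rung R3 = continuum SU(2) Yang–Mills on the three-torus — a RUNG, NOT the Clay problem: not
d = 4, not infinite volume, not a mass gap), width seat `ym-ust-19936-w3` gen 10; helper for the registered skeleton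
`Cruxes/HistoryTailL/Lines/revelation_martingale.lean` (v3), complementary to the sibling seat's «tree-gauge zero increment»
(fresh-vertex bonds carry no increment).  Route-independent imports.  Nothing here proves a stub, the deciding crux
`SubGaussianRevelationL` (stmt-QuantumFields-23082), `HistoryTailL` or a summit statement: this is the bookkeeping half of the
card's revelation-order sentence «… then the loop-closing bonds outward from `∂p`» — bonds OUTSIDE the support of the
observable carry nothing.

WHAT.
* §1 (any `Filtration ℕ`, pure measure theory) `condExp_succ_sub_eq_zero_of_stronglyMeasurable`: an integrable `f` that is
  `ℱ i₀`-measurable has `μ[f|ℱ (i+1)] − μ[f|ℱ i] = 0` for every `i ≥ i₀` (pointwise); hence (`mgfRow_of_stronglyMeasurable`)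
  the stubs' conditional-MGF row at such an index holds with ANY proxy value `σ ≥ 0`, the conditional squared increment
  vanishes (`condExp_incr_sq_eq_zero_of_stronglyMeasurable`), and (`proxy_truncation`) proxies obeying the rows may be
  replaced by their TRUNCATION `σ' i := if i < i₀ then σ i else 0` (adapted, non-negative, rows, smaller sums): WLOG the
  proxies vanish beyond the support horizon.
* §2 (THE masked bond-revelation σ-algebras `comap (U ↦ (m ↦ if m < i then U (e m) else 1))` of
  ✓`RevelationMartingaleBondFiltration`, generic `P`, `G`) `measurable_comap_bondReveal_of_dependsOn`: a measurable `f`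
  that depends on `U` only through the bonds of a set `S`, all of which are among `e 0, …, e (i₀−1)`, is measurable for the
  `i₀`-th revelation σ-algebra.
* §3 (the line's observable `f = dist1(Ū^j(∂p))`, `Ū^j` = Bałaban's `j`-fold (0.4) average `Averaging.iter (blockAvg ℰp) j`)
  `dist1_iter_plaqHol_dependsOn_blocks`: `f` depends on `U` only through the finest bonds with BOTH endpoints in the four
  `j`-blocks of the corners of `p` (✓`AvgIterLocality.plaqHol_iter_congr₂`, [Balaban1987RG1] (0.4) p.253);
  `stronglyMeasurable_bondReveal_dist1_iter_plaqHol`: hence `f` is `ℱ i₀`-measurable for every filtration pinned to the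
  revelation of `e` once those bonds are among `e 0, …, e (i₀−1)`; and `bondRevelation_rows_beyond_support`: there, under
  `gibbsK`, the Doob increments of BOTH registered bond stubs vanish for `i ≥ i₀`, their MGF rows hold with `σ i = 0`, and
  the predictable-quadratic-variation terms vanish.
JOINT READING with the tree-gauge lemma: the non-zero proxy index set of either bond stub is contained in
{loop-closing bonds} ∩ {bonds with both ends in the footprint}.  EXACT COUNT (d = 3, the four `j`-blocks of the corners of
`p` distinct and not wrapping around the torus): footprint = `4·L^{3j}` fine sites; bonds with both endpoints inside =
`4·(3·L^{3j} − 3·L^{2j})` (inside the blocks) `+ 4·L^{2j}` (across the four shared faces) `= 12·L^{3j} − 8·L^{2j}`; it is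
connected, so its loop-closing bonds number `#bonds − #sites + 1 = 8·L^{3j} − 8·L^{2j} + 1` — the card's «≈ 4·L^{3j}»
with the constant made explicit (prose count; the kernel statements below are count-free). [folklore]
-/

namespace Summit.QuantumFields.YangMills.Theorems.RevelationMartingaleSupportHorizon

open scoped BigOperators Classical MeasureTheory
open Filter MeasureTheory

/-! ## §1  Beyond the horizon of an `ℱ i₀`-measurable observable every increment vanishes -/

section AlongFiltration

variable {Ω : Type*} {mΩ : MeasurableSpace Ω} {μ : Measure Ω} [IsFiniteMeasure μ]

/-- If `f` is integrable and `ℱ i₀`-measurable then `μ[f|ℱ i] = f` for every `i ≥ i₀`. [folklore] -/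
theorem condExp_eq_self_of_stronglyMeasurable (ℱ : Filtration ℕ mΩ) {f : Ω → ℝ} (hf : Integrable f μ) {i₀ : ℕ}
    (hfi₀ : StronglyMeasurable[ℱ i₀] f) {i : ℕ} (hi : i₀ ≤ i) : μ[f|ℱ i] = f :=
  condExp_of_stronglyMeasurable (ℱ.le i) (hfi₀.mono (ℱ.mono hi)) hf

/-- **ZERO INCREMENTS BEYOND THE HORIZON.**  If `f` is integrable and `ℱ i₀`-measurable then the Doob increment
`μ[f|ℱ (i+1)] − μ[f|ℱ i]` is identically `0` for every `i ≥ i₀`. [folklore] -/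
theorem condExp_succ_sub_eq_zero_of_stronglyMeasurable (ℱ : Filtration ℕ mΩ) {f : Ω → ℝ} (hf : Integrable f μ)
    {i₀ : ℕ} (hfi₀ : StronglyMeasurable[ℱ i₀] f) {i : ℕ} (hi : i₀ ≤ i) (ω : Ω) :
    (μ[f|ℱ (i + 1)]) ω - (μ[f|ℱ i]) ω = 0 := by
  rw [condExp_eq_self_of_stronglyMeasurable ℱ hf hfi₀ hi,
    condExp_eq_self_of_stronglyMeasurable ℱ hf hfi₀ (hi.trans (Nat.le_succ i)), sub_self]

/-- Beyond the horizon the stubs' conditional-MGF row holds with ANY non-negative proxy value (the integrand is `exp 0 = 1`).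
[folklore] -/
theorem mgfRow_of_stronglyMeasurable (ℱ : Filtration ℕ mΩ) {f : Ω → ℝ} (hf : Integrable f μ)
    {i₀ : ℕ} (hfi₀ : StronglyMeasurable[ℱ i₀] f) {i : ℕ} (hi : i₀ ≤ i) (s : ℝ) {σ : Ω → ℝ} (hσ : ∀ ω, 0 ≤ σ ω) :
    μ[fun ω => Real.exp (s * ((μ[f|ℱ (i + 1)]) ω - (μ[f|ℱ i]) ω)) | ℱ i] ≤ᵐ[μ] fun ω => Real.exp (s ^ 2 * σ ω / 2) := by
  have h1 : (fun ω => Real.exp (s * ((μ[f|ℱ (i + 1)]) ω - (μ[f|ℱ i]) ω))) = fun _ => (1 : ℝ) := by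
    funext ω
    rw [condExp_succ_sub_eq_zero_of_stronglyMeasurable ℱ hf hfi₀ hi ω, mul_zero, Real.exp_zero]
  rw [h1, condExp_const (ℱ.le i) (1 : ℝ)]
  exact Eventually.of_forall fun ω => Real.one_le_exp (by have := hσ ω; positivity)

/-- Beyond the horizon the conditional squared increment vanishes. [folklore] -/
theorem condExp_incr_sq_eq_zero_of_stronglyMeasurable (ℱ : Filtration ℕ mΩ) {f : Ω → ℝ} (hf : Integrable f μ)
    {i₀ : ℕ} (hfi₀ : StronglyMeasurable[ℱ i₀] f) {i : ℕ} (hi : i₀ ≤ i) :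
    μ[fun ω => ((μ[f|ℱ (i + 1)]) ω - (μ[f|ℱ i]) ω) ^ 2 | ℱ i] = fun _ => (0 : ℝ) := by
  have h1 : (fun ω => ((μ[f|ℱ (i + 1)]) ω - (μ[f|ℱ i]) ω) ^ 2) = fun _ => (0 : ℝ) := by
    funext ω
    rw [condExp_succ_sub_eq_zero_of_stronglyMeasurable ℱ hf hfi₀ hi ω, sq, mul_zero]
  rw [h1, condExp_const (ℱ.le i) (0 : ℝ)]

/-- **PROXY TRUNCATION (WLOG the proxies vanish beyond the horizon).**  If `f` is integrable and `ℱ i₀`-measurable and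
proxies `σ` obey the stubs' rows (adapted, non-negative, conditional-MGF row for all `i, s`), then so do the truncated
proxies `σ' i := if i < i₀ then σ i else 0`, and their partial sums are dominated by those of `σ` — so every window budget
`Σ_{i<N} σ i ≤ v` transfers. [folklore] -/
theorem proxy_truncation (ℱ : Filtration ℕ mΩ) {f : Ω → ℝ} (hf : Integrable f μ)
    {i₀ : ℕ} (hfi₀ : StronglyMeasurable[ℱ i₀] f) {σ : ℕ → Ω → ℝ}
    (hσm : ∀ i, StronglyMeasurable[ℱ i] (σ i)) (hσ0 : ∀ i ω, 0 ≤ σ i ω)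
    (hmgf : ∀ (i : ℕ) (s : ℝ), μ[fun ω => Real.exp (s * ((μ[f|ℱ (i + 1)]) ω - (μ[f|ℱ i]) ω)) | ℱ i]
      ≤ᵐ[μ] fun ω => Real.exp (s ^ 2 * σ i ω / 2)) :
    (∀ i, StronglyMeasurable[ℱ i] (fun ω => if i < i₀ then σ i ω else 0)) ∧
    (∀ i ω, 0 ≤ (if i < i₀ then σ i ω else 0)) ∧
    (∀ (i : ℕ) (s : ℝ), μ[fun ω => Real.exp (s * ((μ[f|ℱ (i + 1)]) ω - (μ[f|ℱ i]) ω)) | ℱ i]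
      ≤ᵐ[μ] fun ω => Real.exp (s ^ 2 * (if i < i₀ then σ i ω else 0) / 2)) ∧
    (∀ N ω, ∑ i ∈ Finset.range N, (if i < i₀ then σ i ω else 0) ≤ ∑ i ∈ Finset.range N, σ i ω) ∧
    (∀ N ω, ∑ i ∈ Finset.range N, (if i < i₀ then σ i ω else 0)
      = ∑ i ∈ Finset.range (min N i₀), σ i ω) := by
  refine ⟨fun i => ?_, fun i ω => ?_, fun i s => ?_, fun N ω => ?_, fun N ω => ?_⟩
  · by_cases hi : i < i₀
    · simp only [hi, if_true]; exact hσm i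
    · simp only [hi, if_false]; exact stronglyMeasurable_const
  · by_cases hi : i < i₀
    · simp only [hi, if_true]; exact hσ0 i ω
    · simp only [hi, if_false]; exact le_rfl
  · by_cases hi : i < i₀
    · simp only [hi, if_true]; exact hmgf i s
    · simp only [hi, if_false]
      exact mgfRow_of_stronglyMeasurable ℱ hf hfi₀ (not_lt.mp hi) s fun _ => le_rfl
  · exact Finset.sum_le_sum fun i _ => by
      by_cases hi : i < i₀
      · simp only [hi, if_true]; exact le_rfl
      · simp only [hi, if_false]; exact hσ0 i ω
  · rw [← Finset.sum_filter]
    congr 1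
    ext i
    simp only [Finset.mem_filter, Finset.mem_range, lt_min_iff]

end AlongFiltration

/-! ## §2  The masked bond revelation sees every observable supported on already-revealed bonds -/

section BondReveal

open Literature.MathematicalPhysics.QuantumFieldTheory.Balaban1983to89

variable {P : Params} {G : Type*} [GaugeGroup G] [MeasurableSpace G]

/-- **SUPPORT ⊆ REVEALED ⇒ MEASURABLE FOR THE REVELATION σ-ALGEBRA.**  Let `e : Fin N → PBond P 0` be an enumeration and
`i₀ : ℕ`.  If a measurable observable `f` of the finest gauge field depends on `U` only through the bonds of a set `S`
(`U = U'` on `S` ⇒ `f U = f U'`) and every bond of `S` is `e m` for some `m < i₀`, then `f` is measurable for the `i₀`-th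
masked-revelation σ-algebra `comap (U ↦ (m ↦ if m < i₀ then U (e m) else 1))` (witness: `f` of the field rebuilt from
the revealed values, `1` elsewhere). [folklore] -/
theorem measurable_comap_bondReveal_of_dependsOn {N : ℕ} (e : Fin N → PBond P 0) (i₀ : ℕ)
    {S : Set (PBond P 0)} (hS : ∀ b ∈ S, ∃ m : Fin N, (m : ℕ) < i₀ ∧ e m = b)
    {f : GaugeField P 0 G → ℝ} (hf : Measurable f)
    (hdep : ∀ U U' : GaugeField P 0 G, (∀ b ∈ S, U b = U' b) → f U = f U') :
    Measurable[MeasurableSpace.comap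
      (fun (U : GaugeField P 0 G) (m : Fin N) => if (m : ℕ) < i₀ then U (e m) else (1 : G)) inferInstance] f := by
  -- rebuild a field from revealed values
  let rebuild : (Fin N → G) → GaugeField P 0 G := fun v b =>
    if h : ∃ m : Fin N, (m : ℕ) < i₀ ∧ e m = b then v (Classical.choose h) else 1
  have hreb : Measurable rebuild := by
    refine measurable_pi_lambda _ fun b => ?_
    by_cases h : ∃ m : Fin N, (m : ℕ) < i₀ ∧ e m = b
    · simp only [rebuild, h, dif_pos]; exact measurable_pi_apply _
    · simp only [rebuild, h, dif_neg, not_false_eq_true]; exact measurable_const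
  have hfac : f = (f ∘ rebuild) ∘
      (fun (U : GaugeField P 0 G) (m : Fin N) => if (m : ℕ) < i₀ then U (e m) else (1 : G)) := by
    funext U
    simp only [Function.comp_apply]
    refine hdep U _ fun b hb => ?_
    have h : ∃ m : Fin N, (m : ℕ) < i₀ ∧ e m = b := hS b hb
    have hc := Classical.choose_spec h
    simp only [rebuild, h, dif_pos, hc.1, if_true]
    rw [hc.2]
  rw [hfac]
  exact (hf.comp hreb).comp (measurable_iff_comap_le.mpr le_rfl)

end BondReveal

/-! ## §3  The line's observable: support = the four `j`-blocks of the corners of `p` -/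

section Line

open Literature.MathematicalPhysics.QuantumFieldTheory.Balaban1983to89
  Literature.MathematicalPhysics.QuantumFieldTheory.Balaban1983to89.T3ContinuumYM3Torus
open Literature.MathematicalPhysics.QuantumFieldTheory.Balaban1983to89.B5Eq118OneStroke (iterBlockOf)
open Literature.MathematicalPhysics.QuantumFieldTheory.Balaban1983to89.T4ReflectionConeSharp (twoBlockLocal_blockAvg)
open Summit.QuantumFields.YangMills.Theorems.AvgIterLocality (plaqHol_iter_congr₂)

/-- **FOUR-`j`-BLOCK SUPPORT of `dist1(Ū^j(∂p))`** (any cut-off `K`, `j ≤ K`): the observable depends on the finest field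
only through the bonds with BOTH endpoints in the four `j`-blocks of the corners of `p` — Bałaban's (0.4) locality iterated
(✓`AvgIterLocality.plaqHol_iter_congr₂`). [cite: Balaban1987RG1, (0.4)+(0.11) p.253] -/
theorem dist1_iter_plaqHol_dependsOn_blocks (F : T3Family) (K j : ℕ) (hjK : j ≤ K) (p : Plaq (F.P K) j)
    (U U' : GaugeField (F.P K) 0 (Matrix.specialUnitaryGroup (Fin 2) ℂ))
    (h : ∀ b : PBond (F.P K) 0, b ∈ {b : PBond (F.P K) 0 |
        (iterBlockOf j b.src = p.src ∨ iterBlockOf j b.src = p.src.shift p.μ ∨ iterBlockOf j b.src = p.src.shift p.ν ∨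
          iterBlockOf j b.src = (p.src.shift p.μ).shift p.ν) ∧
        (iterBlockOf j b.tgt = p.src ∨ iterBlockOf j b.tgt = p.src.shift p.μ ∨ iterBlockOf j b.tgt = p.src.shift p.ν ∨
          iterBlockOf j b.tgt = (p.src.shift p.μ).shift p.ν)} → U b = U' b) :
    GaugeGroup.dist1 (GaugeField.plaqHol
        (Averaging.iter (fun i => BlockAveraging.blockAvg (P := F.P K) (j := i) T3UnitLawDensityEML.ℰp) j U) p) =
      GaugeGroup.dist1 (GaugeField.plaqHol
        (Averaging.iter (fun i => BlockAveraging.blockAvg (P := F.P K) (j := i) T3UnitLawDensityEML.ℰp) j U') p) := by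
  have hs : j ≤ (F.P K).m + (F.P K).K := by
    show j ≤ F.m + K
    omega
  rw [plaqHol_iter_congr₂ (fun i => (BlockAveraging.blockAvg T3UnitLawDensityEML.ℰp :
      Averaging (F.P K) i (Matrix.specialUnitaryGroup (Fin 2) ℂ))) (fun _ => twoBlockLocal_blockAvg _) hs p
    (fun b h1 h2 => h b ⟨h1, h2⟩)]

/-- **SUPPORT HORIZON for the line's observable.**  For an enumeration `e` of the finest bonds and any filtration `ℱ`
pinned to its masked revelation (as in both registered bond stubs), if every finest bond with both endpoints in the four
`j`-blocks of the corners of `p` is among `e 0, …, e (i₀−1)`, then `dist1(Ū^j(∂p))` is `ℱ i₀`-measurable. [folklore] -/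
theorem stronglyMeasurable_bondReveal_dist1_iter_plaqHol (F : T3Family) (K j : ℕ) (hjK : j ≤ K)
    (p : Plaq (F.P K) j) {N : ℕ} (e : Fin N → PBond (F.P K) 0) (i₀ : ℕ)
    (hrev : ∀ b : PBond (F.P K) 0,
        (iterBlockOf j b.src = p.src ∨ iterBlockOf j b.src = p.src.shift p.μ ∨ iterBlockOf j b.src = p.src.shift p.ν ∨
          iterBlockOf j b.src = (p.src.shift p.μ).shift p.ν) →
        (iterBlockOf j b.tgt = p.src ∨ iterBlockOf j b.tgt = p.src.shift p.μ ∨ iterBlockOf j b.tgt = p.src.shift p.ν ∨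
          iterBlockOf j b.tgt = (p.src.shift p.μ).shift p.ν) →
        ∃ m : Fin N, (m : ℕ) < i₀ ∧ e m = b)
    (ℱ : MeasureTheory.Filtration ℕ
        (inferInstance : MeasurableSpace (GaugeField (F.P K) 0 (Matrix.specialUnitaryGroup (Fin 2) ℂ))))
    (hℱ : ∀ i, ℱ i = MeasurableSpace.comap
      (fun (U : GaugeField (F.P K) 0 (Matrix.specialUnitaryGroup (Fin 2) ℂ)) (m : Fin N) =>
        if (m : ℕ) < i then U (e m) else (1 : Matrix.specialUnitaryGroup (Fin 2) ℂ)) inferInstance) :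
    StronglyMeasurable[ℱ i₀] (fun U : GaugeField (F.P K) 0 (Matrix.specialUnitaryGroup (Fin 2) ℂ) =>
      GaugeGroup.dist1 (GaugeField.plaqHol
        (Averaging.iter (fun i => BlockAveraging.blockAvg (P := F.P K) (j := i) T3UnitLawDensityEML.ℰp) j U) p)) := by
  have hf : Measurable fun U : GaugeField (F.P K) 0 (Matrix.specialUnitaryGroup (Fin 2) ℂ) =>
      GaugeGroup.dist1 (GaugeField.plaqHol
        (Averaging.iter (fun i => BlockAveraging.blockAvg (P := F.P K) (j := i) T3UnitLawDensityEML.ℰp) j U) p) :=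
    RegularGaugeGroup.measurable_dist1.comp ((Missing.measurable_plaqHol p).comp
      (T4Continuum.measurable_iter _
        (F.avgMeasurable_of_measurableE T3UnitLawDensityEML.ℰp T3UnitLawDensityEML.measurableE_ℰp K) j))
  have hm := measurable_comap_bondReveal_of_dependsOn (G := Matrix.specialUnitaryGroup (Fin 2) ℂ) e i₀
    (S := {b : PBond (F.P K) 0 |
        (iterBlockOf j b.src = p.src ∨ iterBlockOf j b.src = p.src.shift p.μ ∨ iterBlockOf j b.src = p.src.shift p.ν ∨
          iterBlockOf j b.src = (p.src.shift p.μ).shift p.ν) ∧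
        (iterBlockOf j b.tgt = p.src ∨ iterBlockOf j b.tgt = p.src.shift p.μ ∨ iterBlockOf j b.tgt = p.src.shift p.ν ∨
          iterBlockOf j b.tgt = (p.src.shift p.μ).shift p.ν)})
    (fun b hb => hrev b hb.1 hb.2) hf (dist1_iter_plaqHol_dependsOn_blocks F K j hjK p)
  rw [← hℱ i₀] at hm
  exact hm.stronglyMeasurable

/-- **BEYOND THE SUPPORT HORIZON THE STUBS' ROWS ARE FREE.**  Under `gibbsK`, with `e`, `ℱ`, `i₀` as above: for every
`i ≥ i₀` the Doob increment of `dist1(Ū^j(∂p))` vanishes identically, the conditional-MGF row of both registered bond stubs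
holds at index `i` with the proxy value `0` (indeed with any `σ ≥ 0`), and the predictable-quadratic-variation term at `i`
is `0`.  Combined with `proxy_truncation`: WLOG the stubs' proxies vanish for `i ≥ i₀`, so `Σ_{i<N} σ i = Σ_{i<i₀} σ i`.
[folklore] -/
theorem bondRevelation_rows_beyond_support (F : T3Family) {γ : ℝ} (hγ : 0 ≤ γ) (K j : ℕ) (hjK : j ≤ K)
    (p : Plaq (F.P K) j) {N : ℕ} (e : Fin N → PBond (F.P K) 0) (i₀ : ℕ)
    (hrev : ∀ b : PBond (F.P K) 0,
        (iterBlockOf j b.src = p.src ∨ iterBlockOf j b.src = p.src.shift p.μ ∨ iterBlockOf j b.src = p.src.shift p.ν ∨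
          iterBlockOf j b.src = (p.src.shift p.μ).shift p.ν) →
        (iterBlockOf j b.tgt = p.src ∨ iterBlockOf j b.tgt = p.src.shift p.μ ∨ iterBlockOf j b.tgt = p.src.shift p.ν ∨
          iterBlockOf j b.tgt = (p.src.shift p.μ).shift p.ν) →
        ∃ m : Fin N, (m : ℕ) < i₀ ∧ e m = b)
    (ℱ : MeasureTheory.Filtration ℕ
        (inferInstance : MeasurableSpace (GaugeField (F.P K) 0 (Matrix.specialUnitaryGroup (Fin 2) ℂ))))
    (hℱ : ∀ i, ℱ i = MeasurableSpace.comap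
      (fun (U : GaugeField (F.P K) 0 (Matrix.specialUnitaryGroup (Fin 2) ℂ)) (m : Fin N) =>
        if (m : ℕ) < i then U (e m) else (1 : Matrix.specialUnitaryGroup (Fin 2) ℂ)) inferInstance)
    {i : ℕ} (hi : i₀ ≤ i) :
    (∀ U : GaugeField (F.P K) 0 (Matrix.specialUnitaryGroup (Fin 2) ℂ),
      MeasureTheory.condExp (ℱ (i + 1)) (T3UnitScaleTilt.gibbsK F T3UnitLawDensityEML.ℰp γ K)
          (fun V => GaugeGroup.dist1 (GaugeField.plaqHol
            (Averaging.iter (fun i => BlockAveraging.blockAvg (P := F.P K) (j := i) T3UnitLawDensityEML.ℰp) j V) p)) U -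
        MeasureTheory.condExp (ℱ i) (T3UnitScaleTilt.gibbsK F T3UnitLawDensityEML.ℰp γ K)
          (fun V => GaugeGroup.dist1 (GaugeField.plaqHol
            (Averaging.iter (fun i => BlockAveraging.blockAvg (P := F.P K) (j := i) T3UnitLawDensityEML.ℰp) j V) p)) U
        = 0) ∧
    (∀ (s : ℝ) (σ : GaugeField (F.P K) 0 (Matrix.specialUnitaryGroup (Fin 2) ℂ) → ℝ), (∀ U, 0 ≤ σ U) →
      ∀ᵐ U ∂(T3UnitScaleTilt.gibbsK F T3UnitLawDensityEML.ℰp γ K),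
        MeasureTheory.condExp (ℱ i) (T3UnitScaleTilt.gibbsK F T3UnitLawDensityEML.ℰp γ K)
          (fun U' => Real.exp (s *
            (MeasureTheory.condExp (ℱ (i + 1)) (T3UnitScaleTilt.gibbsK F T3UnitLawDensityEML.ℰp γ K)
                (fun V => GaugeGroup.dist1 (GaugeField.plaqHol
                  (Averaging.iter (fun i => BlockAveraging.blockAvg (P := F.P K) (j := i) T3UnitLawDensityEML.ℰp) j V) p)) U' -
             MeasureTheory.condExp (ℱ i) (T3UnitScaleTilt.gibbsK F T3UnitLawDensityEML.ℰp γ K)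
                (fun V => GaugeGroup.dist1 (GaugeField.plaqHol
                  (Averaging.iter (fun i => BlockAveraging.blockAvg (P := F.P K) (j := i) T3UnitLawDensityEML.ℰp) j V) p)) U'))) U
          ≤ Real.exp (s ^ 2 * σ U / 2)) ∧
    MeasureTheory.condExp (ℱ i) (T3UnitScaleTilt.gibbsK F T3UnitLawDensityEML.ℰp γ K)
        (fun U' => (MeasureTheory.condExp (ℱ (i + 1)) (T3UnitScaleTilt.gibbsK F T3UnitLawDensityEML.ℰp γ K)
              (fun V => GaugeGroup.dist1 (GaugeField.plaqHol
                (Averaging.iter (fun i => BlockAveraging.blockAvg (P := F.P K) (j := i) T3UnitLawDensityEML.ℰp) j V) p)) U' -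
           MeasureTheory.condExp (ℱ i) (T3UnitScaleTilt.gibbsK F T3UnitLawDensityEML.ℰp γ K)
              (fun V => GaugeGroup.dist1 (GaugeField.plaqHol
                (Averaging.iter (fun i => BlockAveraging.blockAvg (P := F.P K) (j := i) T3UnitLawDensityEML.ℰp) j V) p)) U') ^ 2)
      = fun _ => (0 : ℝ) := by
  haveI := T3UnitScaleTilt.isProbabilityMeasure_gibbsK F T3UnitLawDensityEML.ℰp hγ K
  have hfi₀ := stronglyMeasurable_bondReveal_dist1_iter_plaqHol F K j hjK p e i₀ hrev ℱ hℱ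
  have hf_int : Integrable (fun U : GaugeField (F.P K) 0 (Matrix.specialUnitaryGroup (Fin 2) ℂ) =>
      GaugeGroup.dist1 (GaugeField.plaqHol
        (Averaging.iter (fun i => BlockAveraging.blockAvg (P := F.P K) (j := i) T3UnitLawDensityEML.ℰp) j U) p))
      (T3UnitScaleTilt.gibbsK F T3UnitLawDensityEML.ℰp γ K) := by
    refine Integrable.of_bound (hfi₀.mono (ℱ.le i₀)).aestronglyMeasurable 2 (Eventually.of_forall fun U => ?_)
    rw [Real.norm_eq_abs]
    exact RevelationMartingaleProxyQV.abs_dist1_iter_plaqHol_le_two F K j p U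
  exact ⟨fun U => condExp_succ_sub_eq_zero_of_stronglyMeasurable ℱ hf_int hfi₀ hi U,
    fun s σ hσ => mgfRow_of_stronglyMeasurable ℱ hf_int hfi₀ hi s hσ,
    condExp_incr_sq_eq_zero_of_stronglyMeasurable ℱ hf_int hfi₀ hi⟩

end Line

end Summit.QuantumFields.YangMills.Theorems.RevelationMartingaleSupportHorizon
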